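import Summits.ResolutionOfSingularities.ResolutionOfSingularities.Theorems.HilbertSamuelEliminationCampaignW42ConePointResidueRational
import Summits.ResolutionOfSingularities.ResolutionOfSingularities.Theorems.HilbertSamuelEliminationCampaignW42ConeVertexRidge
import Summits.ResolutionOfSingularities.ResolutionOfSingularities.Theorems.HilbertSamuelEliminationCampaignW42HypersurfaceSectionRidge
import HarnessLib

/-!
# [OURS · L1 W4.2] The ridge of a cone does not grow under localization at a prime: `dim F(O_{C,𝔓}) + dim S/𝔓 ≤ dim F(C)`
# whenever `H⁽ᵈ⁾(O_{C,𝔓}) = H(S/I)` (Dietel (8.2.7.B) for cones, in Giraud-ridge form; campaign s42, cell res-hironaka;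
# informal crux `RidgeConfinement`, stmt-ResolutionOfSingularities-17845; `--supports`; brick B7 of the unconditional
# `RidgeDimMonotone`)

HONEST FRAMING. OURS (slot W4.2, prover res-L1-s42-pv-1, gen 5). `K` any field, `I ⊆ S = K[X_1, …, X_n]` a homogeneous ideal
without linear forms, `𝔓 ⊇ I` a prime, `d = dim S/𝔓`, `O = O_{C,𝔓} = (S/I)_{𝔓/I}`. THEOREM
(`localRidgeDim_add_le_ridgeDim_of_hilbertFunQuot_le_hilbertSamuelFun`): if `H(S/I) ≤ H⁽ᵈ⁾(O)` (pointwise; by Bennett–Singh this is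
the equality case of upper semicontinuity along the cone) then

  `dim F(O) + d ≤ dim F(C) = ridgeDim I`.

This is the ridge («Rückgrat») half of B. Dietel's Satz (8.2.7) for the cone, equivalently CJS Thm. 3.10 (4) for cones at a
perfect coefficient field, proved here for EVERY field `K` because Giraud's ridge — unlike the directrix — is insensitive to
inseparable residue extensions. Proof («Λ-trick», no transcendence bases): with `L = Frac(S/𝔓)` and the thickening
`B = (T[Y])_𝔔` of `O` (`…ConePointThickening`: `H⁽⁰⁾(B) = H⁽ⁿ⁾(O)`, `dim F(B) = dim F(O) + n`) and its second face
`B/𝔪_{S_𝔓} B ≅ O_{C_L, x̄}` (`…ConePointResidueRational`, `𝔪_{S_𝔓}` on `h = n − d` generators) the chain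
`H(S/I)⁽ʰ⁺¹⁾ ≤ H⁽ⁿ⁺¹⁾(O) = H⁽¹⁾(B) ≤ H⁽ʰ⁺¹⁾(O_{C_L,x̄}) ≤ H⁽ʰ⁺¹⁾(O_{C_L,0}) = H(S/I)⁽ʰ⁺¹⁾` (hypersurface sections; semicontinuity
along `C_L`; the vertex) collapses; so `x̄` lies in the ridge of `C_L` (g2's cone theorem), `O_{C_L,x̄} ≅ O_{C_L,0}` has
`dim F = dim F(C)` (`…ConeVertexRidge`), and the `h` hypersurface sections in the equality case cost at most `h` ridge dimensions
(`…HypersurfaceSectionRidge`): `dim F(O) + n = dim F(B) ≤ dim F(C) + h`.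

NOTHING here is a statement of H. Hironaka's manuscript [Hironaka2017]. AI review is weaker than expert review. References
(orientation only): B. Dietel, Dissertation Regensburg (2015), Satz (8.2.7) p. 105, (8.2.3)–(8.2.6); V. Cossart, U. Jannsen,
S. Saito, LNM 2270 (2020), Thm. 3.10, proof p. 46–50; J. Giraud, *Bull. Sci. Math.* 99 (1975) §1.5.
-/

noncomputable section

-- single-conjunct summit: the doubled namespace component `ResolutionOfSingularities` is mandated
set_option linter.dupNamespace false
-- localizations of polynomial rings over quotient rings: nested instance problems (as in the gen-3/4 files)
set_option maxSynthPendingDepth 3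

open IsLocalRing MvPolynomial Module
open Literature.RingTheory.HilbertSamuel
open Literature.RingTheory.MvPolynomial (idealDegree)
open Literature.AlgebraicGeometry.Resolution

namespace Summit.ResolutionOfSingularities.ResolutionOfSingularities.Theorems

namespace CampaignW42

universe u

section Structure

variable {K : Type u} [Field K] {n : ℕ} {I 𝔓 : Ideal (MvPolynomial (Fin n) K)} (hI𝔓 : I ≤ 𝔓)
  (L : Type u) [Field L] [Algebra (MvPolynomial (Fin n) K ⧸ 𝔓) L] [IsFractionRing (MvPolynomial (Fin n) K ⧸ 𝔓) L]
  {Q : Ideal (MvPolynomial (Fin n) (MvPolynomial (Fin n) K ⧸ I))} [Q.IsPrime]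
  (hQ : Q = RingHom.ker (eval₂Hom ((algebraMap (MvPolynomial (Fin n) K ⧸ 𝔓) L).comp (Ideal.Quotient.factor hI𝔓))
    (fun i : Fin n => algebraMap (MvPolynomial (Fin n) K ⧸ 𝔓) L (Ideal.Quotient.mk 𝔓 (X i)))))
  [𝔓.IsPrime] {P' : Ideal (MvPolynomial (Fin n) K ⧸ I)} [P'.IsPrime] (hP' : P' = 𝔓.map (Ideal.Quotient.mk I))

/-- [notation] `T = S/I`, the coordinate ring of the cone. -/
local notation3 "T" => MvPolynomial (Fin n) K ⧸ I
/-- [notation] `D = S/𝔓`. -/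
local notation3 "D" => MvPolynomial (Fin n) K ⧸ 𝔓
/-- [notation] `x̄ ∈ Lⁿ`, the images of the variables. -/
local notation3 "xbar" => fun i : Fin n => algebraMap (MvPolynomial (Fin n) K ⧸ 𝔓) L (Ideal.Quotient.mk 𝔓 (X i))
/-- [notation] `I_L = I · L[X]`, written as in `…ConePointResidueRational` (through `D[X] → L[X]`). -/
local notation3 "IL" => (I.map (MvPolynomial.map (algebraMap K (MvPolynomial (Fin n) K ⧸ 𝔓)))).map
  (@algebraMap (MvPolynomial (Fin n) (MvPolynomial (Fin n) K ⧸ 𝔓)) (MvPolynomial (Fin n) L) _ _ MvPolynomial.algebraMvPolynomial)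
/-- [notation] `ι₂ : S = K[Y] → T[Y]`. -/
local notation3 "ι₂" => MvPolynomial.map (σ := Fin n) (algebraMap K (MvPolynomial (Fin n) K ⧸ I))
/-- [notation] `E₂ = 𝔓(Y) · T[Y]`. -/
local notation3 "E₂" => 𝔓.map ι₂
/-- [notation] the thickening `B = (T[Y])_𝔔`. -/
local notation3 "B" => Localization.AtPrime Q
/-- [notation] `O = O_{C,𝔓}`. -/
local notation3 "O" => Localization.AtPrime P'
/-- [notation] `Rp = S_𝔓`, the regular side. -/
local notation3 "Rp" => Localization.AtPrime 𝔓
/-- [notation] `θ₂ : Rp → B`, the structure map of the regular side. -/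
local notation3 "θ₂" => Localization.localRingHom 𝔓 Q (MvPolynomial.map (σ := Fin n) (algebraMap K (MvPolynomial (Fin n) K ⧸ I)))
  (prime_eq_comap_ι₂ hI𝔓 L hQ)

omit [IsFractionRing (MvPolynomial (Fin n) K ⧸ 𝔓) L] [𝔓.IsPrime] in
/-- `I_L = I · L[X]` along `K → D → L`. [folklore] -/
theorem coneIdealL_eq_map :
    IL = I.map (MvPolynomial.map ((algebraMap D L).comp (algebraMap K D))) := by
  rw [Ideal.map_map]
  congr 1
  refine RingHom.ext fun p => ?_
  rw [RingHom.comp_apply, MvPolynomial.algebraMap_def, MvPolynomial.map_map]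

omit [IsFractionRing (MvPolynomial (Fin n) K ⧸ 𝔓) L] [𝔓.IsPrime] in
include hI𝔓 in
/-- `I_L` vanishes at the point `x̄`. [folklore] -/
theorem coneIdealL_le_ker_eval : IL ≤ RingHom.ker (eval xbar) := by
  rw [Ideal.map_le_iff_le_comap, ← ker_eval₂Hom_eq_comap_ker_eval L]
  exact map_le_ker_eval₂Hom hI𝔓 L

include hI𝔓 hQ hP' in
/-- **Dietel (8.2.7.B) for the cone, at the concrete local ring `O = T_{𝔓/I}`**: if `I` is homogeneous without linear forms and
`H(S/I) ≤ H⁽ᵈ⁾(O)`, `d = dim S/𝔓`, then `dim F(O) + d ≤ ridgeDim I`. [cite: Dietel2015, Satz (8.2.7) p. 105]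
[cite: CossartJannsenSaito2020, Thm. 3.10 (4)] -/
theorem localRidgeDim_conePrime_add_le (hI : IsHomogeneousIdeal I) (hI1 : finrank K (idealDegree I 1) = 0) {d : ℕ}
    (hd : ringKrullDim (MvPolynomial (Fin n) K ⧸ 𝔓) = d) (hH : hilbertFunQuot K n I ≤ hilbertSamuelFun O d) :
    localRidgeDim O + d ≤ ridgeDim I := by
  classical
  -- the ideal `I_L` of the cone `C_L`
  have hIL_eq := coneIdealL_eq_map (I := I) (𝔓 := 𝔓) L
  have hILhom : IsHomogeneousIdeal IL := by rw [hIL_eq]; exact isHomogeneousIdeal_map _ hI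
  have hIL1 : finrank L (idealDegree IL 1) = 0 := by rw [hIL_eq]; exact finrank_idealDegree_map_one_eq_zero hI _ hI1
  have hHIL : hilbertFunQuot L n IL = hilbertFunQuot K n I := by rw [hIL_eq]; exact hilbertFunQuot_map _ hI
  have hRIL : ridgeDim IL = ridgeDim I := by rw [hIL_eq]; exact ridgeDim_map_eq hI _
  have hILv : IL ≤ RingHom.ker (eval xbar) := coneIdealL_le_ker_eval hI𝔓 L
  have hIL0 : IL ≤ RingHom.ker (eval (0 : Fin n → L)) := by
    intro f hf
    rw [RingHom.mem_ker, MvPolynomial.eval_zero, constantCoeff_eq]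
    by_contra hc
    have h0 : homogeneousComponent 0 f ∈ IL := hILhom f hf 0
    rw [homogeneousComponent_zero] at h0
    have htop : IL = ⊤ := Ideal.eq_top_of_isUnit_mem _ h0 ((isUnit_iff_ne_zero.mpr hc).map C)
    exact RingHom.ker_ne_top (eval xbar) (top_le_iff.mp (htop.symm.trans_le hILv))
  haveI hmaxv : ((RingHom.ker (eval xbar)).map (Ideal.Quotient.mk IL)).IsMaximal := isMaximal_map_ker_eval hILv
  haveI hmax0 : ((RingHom.ker (eval (0 : Fin n → L))).map (Ideal.Quotient.mk IL)).IsMaximal := isMaximal_map_ker_eval hIL0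
  set Lv := Localization.AtPrime ((RingHom.ker (eval xbar)).map (Ideal.Quotient.mk IL)) with hLvdef
  set L₀ := Localization.AtPrime ((RingHom.ker (eval (0 : Fin n → L))).map (Ideal.Quotient.mk IL)) with hL₀def
  -- (1) the thickening
  have hHB : hilbertFun B = hilbertSamuelFun O n := hilbertFun_thickening hI𝔓 L hQ hP'
  have hRB : localRidgeDim B = localRidgeDim O + n := localRidgeDim_thickening hI𝔓 L hQ hP'
  -- (2) the regular side and the surjection `Φ : B → Lv` with kernel on `h` generators
  obtain ⟨h, t, hhd, ht⟩ := exists_span_eq_maximalIdeal_regularSide (𝔓 := 𝔓) hd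
  have hker : (maximalIdeal Rp).map θ₂ = (E₂).map (algebraMap (MvPolynomial (Fin n) T) B) :=
    map_maximalIdeal_regularSide hI𝔓 L hQ
  obtain ⟨e⟩ := nonempty_ringEquiv_thickening_mod_regular hI𝔓 L hQ
  let Φ : B →+* Lv := e.toRingHom.comp (Ideal.Quotient.mk ((E₂).map (algebraMap (MvPolynomial (Fin n) T) B)))
  have hΦsurj : Function.Surjective Φ := e.surjective.comp Ideal.Quotient.mk_surjective
  have hΦker : RingHom.ker Φ = Ideal.span (Set.range (θ₂ ∘ t)) := by
    change RingHom.ker (e.toRingHom.comp _) = _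
    rw [← RingHom.comap_ker, (RingHom.injective_iff_ker_eq_bot e.toRingHom).mp e.injective, ← RingHom.ker_eq_comap_bot,
      Ideal.mk_ker, ← hker, ← ht, Ideal.map_span, ← Set.range_comp]
  have ht𝔪 : ∀ j, (θ₂ ∘ t) j ∈ maximalIdeal B := fun j =>
    map_nonunit θ₂ (t j) (by rw [← ht]; exact Ideal.subset_span ⟨j, rfl⟩)
  letI algBLv : Algebra B Lv := Φ.toAlgebra
  -- (3) the chain of Hilbert functions
  have ha : hilbertSamuelFun B 1 ≤ hilbertSamuelFun Lv (h + 1) := by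
    rw [add_comm h 1]
    exact hilbertSamuelFun_le_of_ker_le_span_range hΦsurj (θ₂ ∘ t) ht𝔪 hΦker.le 1
  have hc3 : hilbertSamuelFun Lv (h + 1) ≤ hilbertSamuelFun L₀ (h + 1) := by
    rw [← iterPSum_hilbertSamuelFun Lv h 1, ← iterPSum_hilbertSamuelFun L₀ h 1]
    exact iterPSum_mono h (hilbertSamuelFun_one_localization_cone_le hILhom xbar Lv L₀)
  have he0 : hilbertFun L₀ = hilbertFunQuot K n I := (hilbertFun_localization_vertex_eq_hilbertFunQuot hILhom L₀).trans hHIL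
  have hc4 : hilbertSamuelFun L₀ (h + 1) = iterPSum (h + 1) (hilbertFunQuot K n I) := by
    change iterPSum (h + 1) (hilbertFun L₀) = _
    rw [he0]
  have hc2 : hilbertSamuelFun B 1 = hilbertSamuelFun O (n + 1) := by
    change iterPSum 1 (hilbertFun B) = _
    rw [hHB, iterPSum_hilbertSamuelFun O 1 n, add_comm]
  have hc1 : iterPSum (h + 1) (hilbertFunQuot K n I) ≤ hilbertSamuelFun B 1 := by
    rw [hc2, show n + 1 = (h + 1) + d by omega, ← iterPSum_hilbertSamuelFun O (h + 1) d]
    exact iterPSum_mono (h + 1) hH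
  have hBv : hilbertSamuelFun B 1 = hilbertSamuelFun Lv (h + 1) :=
    le_antisymm ha (hc3.trans ((hc4.trans_le hc1)))
  have hv0 : hilbertSamuelFun Lv (h + 1) = hilbertSamuelFun L₀ (h + 1) :=
    le_antisymm hc3 ((hc4.trans_le hc1).trans ha)
  -- (4) `x̄` is in the ridge of `C_L`; `dim F(Lv) = dim F(C)`
  have hridge : (fun i : Fin n => algebraMap (MvPolynomial (Fin n) K ⧸ 𝔓) L (Ideal.Quotient.mk 𝔓 (X i))) ∈ ridge L IL := by
    refine (mem_ridge_iff_hilbertSamuelFun_eq hILhom xbar Lv L₀).mpr (iterPSum_injective h ?_)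
    rw [iterPSum_hilbertSamuelFun Lv h 1, iterPSum_hilbertSamuelFun L₀ h 1]
    exact hv0
  have hRv : localRidgeDim Lv = ridgeDim IL := localRidgeDim_localization_eq_ridgeDim_of_mem_ridge hILhom hridge hILv hIL1 Lv
  -- (5) the `h` hypersurface sections in the equality case
  have hHF : hilbertSamuelFun Lv h = hilbertFun B := by
    refine iterPSum_injective 1 ?_
    rw [iterPSum_hilbertSamuelFun Lv 1 h, add_comm 1 h, ← hBv]
    rfl
  have hRle : localRidgeDim B ≤ localRidgeDim Lv + h :=
    localRidgeDim_le_localRidgeDim_add_of_hilbertSamuelFun_eq hΦsurj (θ₂ ∘ t) hΦker hHF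
  rw [hRB, hRv, hRIL] at hRle
  omega

end Structure

/-! ## The theorem, for any localization of `S/I` at `𝔓/I` -/

/-- **The ridge of a cone under localization (Dietel (8.2.7.B) for cones; CJS Thm. 3.10 (4) for cones, every field).** Let
`I ⊆ K[X_1, …, X_n]` be a homogeneous ideal containing no linear forms, `𝔓 ⊇ I` a prime ideal with `dim S/𝔓 = d`, and `Lo`
a localization of `S/I` at `𝔓/I` (the local ring `O_{C,𝔓}` of the cone `C = V(I)` at `𝔓`). If `H(S/I) ≤ H⁽ᵈ⁾(O_{C,𝔓})`
(i.e. the Hilbert–Samuel function does not drop from the vertex to `𝔓`), then `dim F(O_{C,𝔓}) + d ≤ dim F(C)`, `F` = Giraud's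
ridge. [cite: Dietel2015, Satz (8.2.7) p. 105] [cite: CossartJannsenSaito2020, Thm. 3.10 (4)] -/
theorem localRidgeDim_add_le_ridgeDim_of_hilbertFunQuot_le_hilbertSamuelFun {K : Type u} [Field K] {n : ℕ}
    {I 𝔓 : Ideal (MvPolynomial (Fin n) K)} (hI : IsHomogeneousIdeal I) (hI1 : finrank K (idealDegree I 1) = 0) [𝔓.IsPrime]
    (hI𝔓 : I ≤ 𝔓) {d : ℕ} (hd : ringKrullDim (MvPolynomial (Fin n) K ⧸ 𝔓) = d) {P' : Ideal (MvPolynomial (Fin n) K ⧸ I)}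
    [P'.IsPrime] (hP' : P' = 𝔓.map (Ideal.Quotient.mk I)) (Lo : Type u) [CommRing Lo]
    [Algebra (MvPolynomial (Fin n) K ⧸ I) Lo] [IsLocalization.AtPrime Lo P'] [IsLocalRing Lo] [IsNoetherianRing Lo]
    (hH : hilbertFunQuot K n I ≤ hilbertSamuelFun Lo d) : localRidgeDim Lo + d ≤ ridgeDim I := by
  let L := FractionRing (MvPolynomial (Fin n) K ⧸ 𝔓)
  haveI : (RingHom.ker (eval₂Hom ((algebraMap (MvPolynomial (Fin n) K ⧸ 𝔓) L).comp (Ideal.Quotient.factor hI𝔓))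
      (fun i : Fin n => algebraMap (MvPolynomial (Fin n) K ⧸ 𝔓) L (Ideal.Quotient.mk 𝔓 (X i))))).IsPrime :=
    RingHom.ker_isPrime _
  let e₀ : Localization.AtPrime P' ≃+* Lo := (IsLocalization.algEquiv P'.primeCompl (Localization.AtPrime P') Lo).toRingEquiv
  have hHO : hilbertFun (Localization.AtPrime P') = hilbertFun Lo := hilbertFun_eq_of_ringEquiv e₀
  have hH' : hilbertFunQuot K n I ≤ hilbertSamuelFun (Localization.AtPrime P') d := by
    change _ ≤ iterPSum d (hilbertFun (Localization.AtPrime P'))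
    rw [hHO]
    exact hH
  rw [← localRidgeDim_eq_of_ringEquiv e₀]
  exact localRidgeDim_conePrime_add_le hI𝔓 L rfl hP' hI hI1 hd hH'

end CampaignW42

end Summit.ResolutionOfSingularities.ResolutionOfSingularities.Theorems

end
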